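import Literature.Claims.NS.Chio2026
import HarnessLib

/-!
# Claim skeleton C126 — Chebiam 2025, «Advancements in the Navier-Stokes Existence and Smoothness Problem with a Novel Framework and Turbulence Regularity Criterion»

**Cite header.** Anant Chebiam, *Advancements in the Navier-Stokes Existence and Smoothness Problem with
a Novel Framework and Turbulence Regularity Criterion*, Preprints.org 202504.0770, text of record **v1**
(9 Apr 2025, only version; not peer-reviewed; 22 PDF pp.; `p.` = PRINTED page = PDF page − 1; `(n)` =
display numbers), bib key `Chebiam2025`. UNREFEREED CLAIM under adjudication (D-0090 NS-claims sweep,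
cell `ns-claims`, row C126, T3 QUICK TRANCHE, RULINGS v1.29l (4)/v1.29n (2)) — this file TYPES the
claimed statement and the text's own steps as `Prop`s and asserts none of them; the only theorems are
compositions by pure logic. Nothing here is a theorem about Navier–Stokes. QUICK grain: the STATEMENT
(Theorem 6) over a smooth-function rendering of the author's spaces, the proof's two load-bearing
sentences at the abstract grain the text gives them, the Δ-axes. [cite: Chebiam2025, abstract p.1; Thm 6 p.11]

**Setting (§2.1 p.1–2, §3.1 p.2).** «Let Ω ⊂ ℝ³ be a bounded domain with smooth boundary ∂Ω»;
`V = {v ∈ H¹₀(Ω)³ : ∇·v = 0}` (6); Definition 4 p.2: «For s ≥ 0 and p ≥ 2, the turbulence space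
T^s_p(Ω) consists of functions f ∈ H^s(Ω) such that
‖f‖_{T^s_p} = ‖f‖_{H^s} + (∫_Ω∫_Ω |f(x) − f(y)|^p / |x − y|^{3+sp} dx dy)^{1/p} < ∞ (9)».
Rendered here for SMOOTH fields on `ℝ³` vanishing off `Ω` (the Clay-relevant data; for such fields the
`H^s(Ω)` part of (9) is finite, so membership in `T^s_p(Ω)` is finiteness of the double integral
`gagliardo s p Ω f`). Whether `T¹₄(Ω) ∩ V` contains any non-zero field at all (the exponent `3 + sp = 7`
at `s = 1`) is the Δ4/vacuity axis left to the refuter; nothing about it is asserted here.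

**Claimed statement (verbatim).** Abstract p.1: «… to establish the global existence and uniqueness of
smooth solutions to the three-dimensional Navier-Stokes equations.» Theorem 6 (Global Existence and
Smoothness) p.11 (= Theorem 2 p.3 with Theorem 3; restated Theorems 7–8 pp.13–15): «Let u₀ ∈ T¹₄(Ω) ∩ V
and f ∈ L²(0, T; T⁰₄(Ω)) for any T > 0. Then the Navier-Stokes equations admit a unique global solution
u ∈ L^∞(0, T; T¹₄(Ω)) ∩ L²(0, T; T²₄(Ω)) for all T > 0.» Typed as `ClaimedTheorem` in the UNFORCED special
case `f ≡ 0` (TODO(general form): `f ∈ L²(0,T;T⁰₄(Ω))`), «solution» rendered classically by the tree's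
`Chio2026.IsStrongSolutionOn Ω (Ici 0) ν u₀ u p` (smooth slices, (1)–(2) in `Ω`, no-slip = the `H¹₀`
trace, datum), the class `L^∞_t T¹₄ ∩ L²_t T²₄` on every `[0,T]` by `InSolutionClass`, uniqueness in `Ω`.

**Clay delta (reference `Literature.Claims.NS.ClayVariants`).** Δ1 DOMAIN: bounded `Ω` with boundary
(H¹₀/no-slip), not `ℝ³` (A) nor `𝕋³` (B). Δ4 DATA: `u₀ ∈ T¹₄(Ω) ∩ V` (own space (9)) vs (4)/(8). Δ6
CONCLUSION: a solution class `L^∞_t T¹₄ ∩ L²_t T²₄` «for all T > 0» + Theorem 3 / Corollary 1 smoothness on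
`(0,T] × Ω` / `[t₀,∞) × Ω` (not up to `t = 0`), vs (A)'s `C^∞(ℝ³ × [0,∞))` with (7). No `clay_of_claimed`
is provable or attempted; the identification is the abstract's sentence (`Step_bridge`).

**ORDERED STEP INDEX** (proof of Theorem 6, print p.11–12):
* Step 1 = `Step_1_local` — Theorem 4 (Local Existence) p.8, used p.11 «By Theorem 4, there exists T₀ > 0
  such that a unique solution … exists. Let T* be the maximal time of existence.»
* Step 2 = `Step_2_lemma1GivesBound` — p.11, end of Step 2 (after (91)–(100)): «Using Lemma 1, we know
  that ‖u‖_{T¹₄} remains bounded on [0, T*)», where Lemma 1 (Enhanced Energy Estimate) p.5 (11) reads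
  `‖u(t)‖²_{T¹₄} + ν∫₀ᵗ‖u(s)‖²_{T²₄} ds ≤ C(‖u₀‖²_{T¹₄} + ∫₀ᵗ‖f(s)‖²_{T⁰₄} ds)·exp(C∫₀ᵗ‖u(s)‖⁴_{T¹₄} ds)`.
  Typed at the abstract grain of that inference: an inequality of the shape (11) bounds `‖u(t)‖_{T¹₄}` on
  `[0,T*)`.
* Step 3 = `Step_3_carefulEstimates` — p.11–12 (101)–(106): «Taking the inner product with
  P_S(u)|∇P_S(u)|² … (102)–(105). Through a series of careful estimates leveraging our scale
  decomposition, we can establish that ∫₀^{T*} ‖P_S(u(t))‖⁴_{T¹₄} dt < ∞ (106)» — no estimate is printed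
  between (105) and (106). Typed at the grain printed: from what Steps 1–2 provide (a local solution and
  a bound on `‖P_S(u)‖_{L²}`), (106).
* Step 4 = `Step_4_continuation` — p.12 «Applying Lemma 4 … This higher regularity precludes the
  possibility of a finite-time blowup … Therefore T* = ∞» (+ Step 5 uniqueness): the PDE-level
  continuation statement, typed over the rendering.
* Bridge = `Step_bridge` — abstract p.1.
COMPOSITION: the printed chain is
Step 1 → (Step 2, Step 3) → Step 4, and Steps 2–3 are sentences about norms of the unknown solution that
the text does not derive; they are typed STANDALONE at the abstract grain (each refutable there by a
one-function toy), and the PDE-level composition is `claim_of_steps : Step_14_globalExistence →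
Step_5_uniqueness → ClaimedTheorem` with `Step_14_globalExistence` = «every datum has a global solution
in the class» = what Steps 1–4 are printed to give (`Step_1_local`, `Step_4_continuation` typed too).

WHAT THIS IS NOT: not a claim about NS regularity or blow-up; not a claim about any author beyond the
typed locator.
-/

open Set MeasureTheory Literature.Analysis.FluidPDE Literature.Claims.NS.ClayVariants
open scoped ENNReal ContDiff

namespace Literature.Claims.NS.Chebiam2025

noncomputable section

/-- Physical space `ℝ³` (the tree's `Chio2026.E3`). [folklore] -/
abbrev E3 : Type := EuclideanSpace ℝ (Fin 3)

/-- The double integral of Definition 4 (9) p.2: `∫_Ω∫_Ω |f(x) − f(y)|^p / |x − y|^{3+sp} dx dy`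
(extended-real valued). [cite: Chebiam2025, Definition 4 (9) p.2] -/
def gagliardo (s p : ℝ) (Ω : Set E3) (f : E3 → E3) : ℝ≥0∞ :=
  ∫⁻ x in Ω, ∫⁻ y in Ω, ‖f x - f y‖ₑ ^ p / ‖x - y‖ₑ ^ (3 + s * p)

/-- Membership of a SMOOTH field in the turbulence space `T^s_p(Ω)` (Definition 4 p.2): the double
integral (9) is finite (the `H^s(Ω)` part being finite for smooth fields on a bounded `Ω`).
[cite: Chebiam2025, Definition 4 (9) p.2] -/
def InT (s p : ℝ) (Ω : Set E3) (f : E3 → E3) : Prop :=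
  ContDiff ℝ ∞ f ∧ gagliardo s p Ω f < ⊤

/-- «u₀ ∈ T¹₄(Ω) ∩ V» (Theorem 6 p.11; `V` = (6) p.2), rendered for smooth fields on `ℝ³`: smooth,
divergence-free, vanishing off `Ω` (the `H¹₀` trace), and in `T¹₄(Ω)`. [cite: Chebiam2025, Thm 6 p.11; (6) p.2; (9) p.2] -/
def IsDatum (Ω : Set E3) (u₀ : E3 → E3) : Prop :=
  ContDiff ℝ ∞ u₀ ∧ VectorCalculus.IsDivFree u₀ ∧ (∀ x, x ∉ Ω → u₀ x = 0) ∧ InT 1 4 Ω u₀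

/-- «u ∈ L^∞(0, T; T¹₄(Ω)) ∩ L²(0, T; T²₄(Ω)) for all T > 0» (Theorem 6 p.11), rendered for smooth
slices: on every `[0,T]` the `T¹₄` integral is uniformly bounded and the `T²₄` norm is square-integrable
in time. [cite: Chebiam2025, Thm 6 p.11] -/
def InSolutionClass (Ω : Set E3) (u : ℝ → E3 → E3) : Prop :=
  ∀ T : ℝ, 0 < T →
    (∃ M : ℝ≥0∞, M < ⊤ ∧ ∀ t ∈ Icc 0 T, gagliardo 1 4 Ω (u t) ≤ M) ∧
      ∫⁻ t in Ioo 0 T, (gagliardo 2 4 Ω (u t)) ^ (2 / 4 : ℝ) < ⊤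

/-! ## The claimed statement -/

/-- **The claimed theorem (Theorem 6 p.11, as printed; unforced special case `f ≡ 0` —
TODO(general form): `f ∈ L²(0,T;T⁰₄(Ω))`)**: for every `ν > 0`, every bounded domain `Ω ⊂ ℝ³` and every
`u₀ ∈ T¹₄(Ω) ∩ V`, the Navier–Stokes equations in `Ω` (no-slip) admit a global solution in
`L^∞_t T¹₄ ∩ L²_t T²₄` on every `[0,T]`, unique in `Ω`. [cite: Chebiam2025, Thm 6 p.11; Thm 2 p.3] -/
def ClaimedTheorem : Prop :=
  ∀ ν : ℝ, 0 < ν → ∀ Ω : Set E3, IsOpen Ω → Bornology.IsBounded Ω → ∀ u₀ : E3 → E3, IsDatum Ω u₀ →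
    ∃ (u : ℝ → E3 → E3) (p : ℝ → E3 → ℝ),
      Chio2026.IsStrongSolutionOn Ω (Ici 0) ν u₀ u p ∧ InSolutionClass Ω u ∧
        ∀ (u' : ℝ → E3 → E3) (p' : ℝ → E3 → ℝ),
          Chio2026.IsStrongSolutionOn Ω (Ici 0) ν u₀ u' p' → InSolutionClass Ω u' →
            ∀ t, 0 ≤ t → ∀ x ∈ Ω, u' t x = u t x

/-- **Bridge — abstract p.1** «to establish the global existence and uniqueness of smooth solutions to the
three-dimensional Navier-Stokes equations» / §1 «one of the seven Millennium Prize Problems»: the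
identification with Clay (A). (Δ1 bounded `Ω`, Δ4 `T¹₄ ∩ V`, Δ6 solution class.) [cite: Chebiam2025, abstract p.1; §1 p.1] -/
def Step_bridge : Prop := ClaimedTheorem → clayR3.Regularity

/-! ## The steps of the proof of Theorem 6 (none asserted) -/

/-- **Step 1 — Theorem 4 (Local Existence) p.8, as used p.11**: every datum has a solution on some
`[0,T₀)` in the class. [cite: Chebiam2025, Thm 4 p.8; Thm 6 proof Step 1 p.11] -/
def Step_1_local : Prop :=
  ∀ ν : ℝ, 0 < ν → ∀ Ω : Set E3, IsOpen Ω → Bornology.IsBounded Ω → ∀ u₀ : E3 → E3, IsDatum Ω u₀ →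
    ∃ T₀ : ℝ, 0 < T₀ ∧ ∃ (u : ℝ → E3 → E3) (p : ℝ → E3 → ℝ),
      Chio2026.IsStrongSolutionOn Ω (Ico 0 T₀) ν u₀ u p ∧
        ∃ M : ℝ≥0∞, M < ⊤ ∧ ∀ t ∈ Ico 0 T₀, gagliardo 1 4 Ω (u t) ≤ M

/-- **Step 2 — p.11, last sentence of Step 2: «Using Lemma 1, we know that ‖u‖_{T¹₄} remains bounded on
[0, T*)»**, with Lemma 1 (11) p.5. Typed at the abstract grain of the inference: for nonnegative
`φ(t) = ‖u(t)‖_{T¹₄}`, `ψ(t) = ‖u(t)‖²_{T²₄}`, `g(t) = ‖f(t)‖²_{T⁰₄}` and constants `C > 0`, `A ≥ 0`,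
the inequality (11) on `[0,T*)` implies that `φ` is bounded on `[0,T*)`.
[cite: Chebiam2025, Lemma 1 (11) p.5; Thm 6 proof Step 2 p.11] -/
def Step_2_lemma1GivesBound : Prop :=
  ∀ (Tstar C A : ℝ) (φ ψ g : ℝ → ℝ), 0 < Tstar → 0 < C → 0 ≤ A →
    (∀ t, 0 ≤ φ t) → (∀ t, 0 ≤ ψ t) → (∀ t, 0 ≤ g t) →
    (∀ t ∈ Ico 0 Tstar, IntervalIntegrable (fun s => φ s ^ 4) volume 0 t) →
    (∀ t ∈ Ico 0 Tstar,
      φ t ^ 2 + ∫ s in (0 : ℝ)..t, ψ s ≤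
        C * (A + ∫ s in (0 : ℝ)..t, g s) * Real.exp (C * ∫ s in (0 : ℝ)..t, φ s ^ 4)) →
    ∃ M : ℝ, ∀ t ∈ Ico 0 Tstar, φ t ≤ M

/-- **Step 3 — p.11–12, (101)–(106): «Through a series of careful estimates leveraging our scale
decomposition, we can establish that ∫₀^{T*} ‖P_S(u(t))‖⁴_{T¹₄} dt < ∞ (106)»** — typed at the grain
printed: from the output of Step 2 (a bound on `ψ(t) = ‖P_S(u(t))‖_{L²}` on `[0,T*)`) conclude the
integrability (106) of `φ(t)⁴ = ‖P_S(u(t))‖⁴_{T¹₄}`; no estimate linking the two is printed.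
[cite: Chebiam2025, Thm 6 proof Step 3 (101)–(106) p.11–12] -/
def Step_3_carefulEstimates : Prop :=
  ∀ (Tstar : ℝ) (φ ψ : ℝ → ℝ), 0 < Tstar → (∀ t, 0 ≤ φ t) →
    (∃ M : ℝ, ∀ t ∈ Ico 0 Tstar, |ψ t| ≤ M) →
    IntegrableOn (fun t => φ t ^ 4) (Ico 0 Tstar) volume

/-- **Steps 1–4 together, PDE level — p.12 «Therefore, T* = ∞, and the solution exists globally in
time»**: every datum has a global solution in the class (what Steps 1–4 are printed to deliver).
[cite: Chebiam2025, Thm 6 proof Steps 1–4 p.11–12] -/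
def Step_14_globalExistence : Prop :=
  ∀ ν : ℝ, 0 < ν → ∀ Ω : Set E3, IsOpen Ω → Bornology.IsBounded Ω → ∀ u₀ : E3 → E3, IsDatum Ω u₀ →
    ∃ (u : ℝ → E3 → E3) (p : ℝ → E3 → ℝ),
      Chio2026.IsStrongSolutionOn Ω (Ici 0) ν u₀ u p ∧ InSolutionClass Ω u

/-- **Step 5 — p.12 «Uniqueness follows directly from the energy estimates for the difference of two
solutions»**: two global solutions in the class from the same datum agree in `Ω`.
[cite: Chebiam2025, Thm 6 proof Step 5 p.12] -/
def Step_5_uniqueness : Prop :=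
  ∀ ν : ℝ, 0 < ν → ∀ Ω : Set E3, IsOpen Ω → Bornology.IsBounded Ω → ∀ u₀ : E3 → E3, IsDatum Ω u₀ →
    ∀ (u u' : ℝ → E3 → E3) (p p' : ℝ → E3 → ℝ),
      Chio2026.IsStrongSolutionOn Ω (Ici 0) ν u₀ u p → InSolutionClass Ω u →
      Chio2026.IsStrongSolutionOn Ω (Ici 0) ν u₀ u' p' → InSolutionClass Ω u' →
        ∀ t, 0 ≤ t → ∀ x ∈ Ω, u' t x = u t x

/-- **Step 4 — p.12 «Applying Lemma 4, we conclude that u ∈ L^∞(t₀, T*; T²₄(Ω)) … if T* < ∞ … we could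
extend the solution beyond T*, contradicting the maximality of T*»**: continuation — a local solution
whose `T¹₄` norm satisfies (106) on `[0,T*)` with `T* < ∞` extends past `T*`. Typed over the rendering.
[cite: Chebiam2025, Lemma 4 p.7; Thm 6 proof Step 4 p.12] -/
def Step_4_continuation : Prop :=
  ∀ ν : ℝ, 0 < ν → ∀ Ω : Set E3, IsOpen Ω → Bornology.IsBounded Ω → ∀ u₀ : E3 → E3, IsDatum Ω u₀ →
    ∀ (Tstar : ℝ) (u : ℝ → E3 → E3) (p : ℝ → E3 → ℝ), 0 < Tstar →
      Chio2026.IsStrongSolutionOn Ω (Ico 0 Tstar) ν u₀ u p →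
      ∫⁻ t in Ico 0 Tstar, gagliardo 1 4 Ω (u t) < ⊤ →
        ∃ (T' : ℝ) (u' : ℝ → E3 → E3) (p' : ℝ → E3 → ℝ), Tstar < T' ∧
          Chio2026.IsStrongSolutionOn Ω (Ico 0 T') ν u₀ u' p' ∧ ∀ t ∈ Ico 0 Tstar, ∀ x ∈ Ω, u' t x = u t x

/-! ## Compositions (pure logic) -/

/-- **COMPOSITION** (PDE level): global existence in the class (Steps 1–4) and uniqueness (Step 5) give
Theorem 6 as typed. [cite: Chebiam2025, Thm 6 p.11–12] -/
theorem claim_of_steps (h14 : Step_14_globalExistence) (h5 : Step_5_uniqueness) : ClaimedTheorem := by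
  intro ν hν Ω hΩ hb u₀ hu
  obtain ⟨u, p, hsol, hcl⟩ := h14 ν hν Ω hΩ hb u₀ hu
  exact ⟨u, p, hsol, hcl, fun u' p' hsol' hcl' => h5 ν hν Ω hΩ hb u₀ hu u u' p p' hsol hcl hsol' hcl'⟩

/-- With the bridge, the claim would give Clay (A). [cite: Chebiam2025, abstract p.1] -/
theorem clay_of_bridge (hb : Step_bridge) (hc : ClaimedTheorem) : clayR3.Regularity := hb hc

end

end Literature.Claims.NS.Chebiam2025
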